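import Summits.CriticalPhenomena.CardyFormulaZ2.Theorems.CardyBoundaryCoulombGasRectilinearCardyStubBoundaryFeetPart1
import Summits.CriticalPhenomena.CardyFormulaZ2.Theorems.CardyBoundaryCoulombGasRectilinearCardyStubBoundaryFeetPart7
import HarnessLib

/-!
# Stub `stub_boundaryFeet` of line `excursion-kernel-covariance` — Part 8:
# the local hypotheses of the cyclic-order lemma (crux `RectilinearCardy`,
# stmt-CriticalPhenomena-5660)

`bft_local`: for an exterior dart `d` of the closure lattice polygon whose foot carries an
oriented wedge (apex `γ t₀`, radius `r`, window `η ≤ 1/4`, frame `a`, type `m`) containing the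
`16 δ`-disc about the foot, the foot parameters `f = bftPar D δ` satisfy the three local
hypotheses of the cyclic-order lemma of Part 1 at `d`:

* (L1) the increment `Δ d = fract (f (dsucc d) - f d)` is `< η'` (inverse uniform continuity of
  `γ` at scale `2 δ`, the tube constant `c`);
* (L2) every exterior dart whose foot parameter lies in the arc `(f d, f d + Δ d]` is `dsucc d` or
  `dsucc (dsucc d)` (its foot lies on the short frontier piece between the feet of `d` and
  `dsucc d`, so it is a dart of the local chain, whose feet are ordered);
* (L3) if `Δ d = 0` then `Δ (dsucc d) ≠ 0` (feet two steps apart are `≥ δ` apart).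
[folklore]
-/

noncomputable section

open Set Filter Metric Topology
open Literature.Probability.RandomPlanarGeometry
open Literature.Probability.LatticeModels Literature.Probability.LatticeModels.CollarLegModel
open Summit.CriticalPhenomena.CardyFormulaZ2.Cruxes.BoundaryDefectGaussianR.RainbowMonomialsInExcursionKernels

namespace Summit.CriticalPhenomena.CardyFormulaZ2.Cruxes.RectilinearCardy.ExcursionKernelCovariance

/-- The increment read through window parameters: if `f d = u₀ + j₀`, `f (dsucc d) = u₁ + j₁`
with `0 ≤ u₁ - u₀ < 1`, then `Δ d = fract (f (dsucc d) - f d) = u₁ - u₀`. [folklore] -/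
theorem bft_inc_eq (V : Finset (ℤ × ℤ)) (f : Dart → ℝ) (d : Dart) {u₀ u₁ : ℝ} {j₀ j₁ : ℤ}
    (h₀ : f d = u₀ + j₀) (h₁ : f (dsucc V d) = u₁ + j₁) (hle : u₀ ≤ u₁) (hlt : u₁ - u₀ < 1) :
    Int.fract (f (dsucc V d) - f d) = u₁ - u₀ := by
  rw [h₀, h₁, show u₁ + (j₁ : ℝ) - (u₀ + j₀) = (u₁ - u₀) + ((j₁ - j₀ : ℤ) : ℝ) by
    push_cast; ring, Int.fract_add_intCast, Int.fract_eq_self.2 ⟨by linarith, hlt⟩]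

/-- **The local hypotheses of the cyclic-order lemma at an exterior dart.** See the module
docstring. [folklore] -/
theorem bft_local (D : JordanDomain) {δ : ℝ} (hδ : 0 < δ) {V : Finset (ℤ × ℤ)}
    (hV : ∀ v : ℤ × ℤ, v ∈ V ↔ bftMesh δ v ∈ closure D.carrier)
    {t₀ r η : ℝ} {a m : ℕ} (hη : 0 < η) (hη4 : η ≤ 1 / 4) (ha4 : a < 4)
    (hm : m = 1 ∨ m = 2 ∨ m = 3)
    (hdirA : ∀ t ∈ Icc t₀ (t₀ + η), D.boundary t =
      D.boundary t₀ + ((‖D.boundary t - D.boundary t₀‖ : ℝ) : ℂ) * Complex.I ^ a)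
    (hmonoA : StrictMonoOn (fun t => ‖D.boundary t - D.boundary t₀‖) (Icc t₀ (t₀ + η)))
    (hrA : r < ‖D.boundary (t₀ + η) - D.boundary t₀‖)
    (hdirB : ∀ t ∈ Icc (t₀ - η) t₀, D.boundary t =
      D.boundary t₀ + ((‖D.boundary t - D.boundary t₀‖ : ℝ) : ℂ) * Complex.I ^ (a + m))
    (hantiB : StrictAntiOn (fun t => ‖D.boundary t - D.boundary t₀‖) (Icc (t₀ - η) t₀))
    (hrB : r < ‖D.boundary (t₀ - η) - D.boundary t₀‖)
    (hfront : ∀ z, dist z (D.boundary t₀) < r → (z ∈ frontier D.carrier ↔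
      (((z - D.boundary t₀) * (-Complex.I) ^ a).im = 0 ∧
          0 ≤ ((z - D.boundary t₀) * (-Complex.I) ^ a).re) ∨
        (((z - D.boundary t₀) * (-Complex.I) ^ (a + m)).im = 0 ∧
          0 ≤ ((z - D.boundary t₀) * (-Complex.I) ^ (a + m)).re)))
    (hdom : ∀ z, dist z (D.boundary t₀) < r → (z ∈ D.carrier ↔
      (m = 1 → 0 < ((z - D.boundary t₀) * (-Complex.I) ^ a).re ∧
          0 < ((z - D.boundary t₀) * (-Complex.I) ^ a).im) ∧
        (m = 2 → 0 < ((z - D.boundary t₀) * (-Complex.I) ^ a).im) ∧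
        (m = 3 → 0 < ((z - D.boundary t₀) * (-Complex.I) ^ a).im ∨
          ((z - D.boundary t₀) * (-Complex.I) ^ a).re < 0)))
    {c η' : ℝ} (hη' : η' ≤ 1 / 4)
    (htube : ∀ s t : ℝ, dist (D.boundary s) (D.boundary t) < c → ∃ n : ℤ, |s - t - n| < η')
    (hδc : 2 * δ < c)
    (d : Dart) (hd : d.1 ∈ V) (hdt : dartTip d ∉ V)
    (hball : ∀ z, dist z (bftPhi D δ d) ≤ 16 * δ → dist z (D.boundary t₀) < r) :
    bftInc V (bftPar D δ) d < η' ∧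
    (∀ d'' : Dart, d''.1 ∈ V → dartTip d'' ∉ V → ∀ j : ℤ,
      bftPar D δ d < bftPar D δ d'' + j → bftPar D δ d'' + j ≤ bftPar D δ d + bftInc V (bftPar D δ) d →
      d'' = dsucc V d ∨ d'' = dsucc V (dsucc V d)) ∧
    (bftInc V (bftPar D δ) d = 0 → bftInc V (bftPar D δ) (dsucc V d) ≠ 0) := by
  obtain ⟨K, rfl⟩ : ∃ K : Fin 4, (K : ℕ) = a := ⟨⟨a, ha4⟩, rfl⟩
  have hclos := tp_closure_chart D hm hfront hdom
  obtain ⟨Pre, hPre⟩ : ∃ Pre : ℝ, Pre = (D.boundary t₀ * (-Complex.I) ^ (K : ℕ)).re := ⟨_, rfl⟩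
  obtain ⟨Pim, hPim⟩ : ∃ Pim : ℝ, Pim = (D.boundary t₀ * (-Complex.I) ^ (K : ℕ)).im := ⟨_, rfl⟩
  have hsm := bft_spos_strictMono D hmonoA hantiB
  have hIoo : ∀ u, u ∈ Ioo (t₀ - η) (t₀ + η) → u ∈ Icc (t₀ - η) (t₀ + η) := fun u hu =>
    ⟨hu.1.le, hu.2.le⟩
  -- the dart, its foot, and the discs about it
  obtain ⟨v, k⟩ := d
  simp only at hd hball
  have hvcl : bftMesh δ v ∈ closure D.carrier := (hV _).1 hd
  have hdt' : v + dir k ∉ V := hdt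
  have hdζ : dist (bftPhi D δ (v, k)) (bftMesh δ v) ≤ δ := (bft_dist_phi_mesh D hδ.le (v, k) hvcl).2
  have hB : ∀ w : ℤ × ℤ, dist (bftMesh δ w) (bftPhi D δ (v, k)) ≤ 13 * δ →
      ∀ z, dist z (bftMesh δ w) ≤ 3 * δ → dist z (D.boundary t₀) < r := fun w hw z hz =>
    hball z (by linarith [dist_triangle z (bftMesh δ w) (bftPhi D δ (v, k))])
  -- `d` is a chain dart
  have hch := bft_frame_chart D hδ hV K hm hclos v (hB v (by rw [dist_comm]; linarith))
  rw [← hPre, ← hPim] at hch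
  obtain ⟨hdv, hdk⟩ := bft_enum V hm K (bftX m δ Pre) ⌈Pim / δ⌉ v k hch hd hdt'
  generalize bftIdx m K (bftX m δ Pre) ⌈Pim / δ⌉ v k = ι at hdv hdk
  subst hdv hdk
  -- chain data for the darts `ι, …, ι + 3`
  have hdata : ∀ κ, ι ≤ κ → κ ≤ ι + 3 → _ := fun κ h1 h2 =>
    bft_chain_data D hδ hV K hη hm hdirA hrA hdirB hrB hclos hPre hPim κ (hB _ (by
      obtain ⟨s, t, he, hs1, hs2, ht1, ht2⟩ := bft_vert_shift hm K (bftX m δ Pre) ⌈Pim / δ⌉ ι (κ - ι).toNat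
      rw [Int.toNat_of_nonneg (by omega), add_sub_cancel] at he
      have hj : ((κ - ι).toNat : ℤ) ≤ 3 := by rw [Int.toNat_of_nonneg (by omega)]; omega
      have hd5 := bft_mesh_frame_dist3 hδ.le K (bftVert m K (bftX m δ Pre) ⌈Pim / δ⌉ ι)
        (s := s) (t := t) (by omega) (by omega) (by omega) (by omega)
      rw [← he] at hd5
      rw [dist_comm] at hdζ
      linarith [dist_triangle (bftMesh δ (bftVert m K (bftX m δ Pre) ⌈Pim / δ⌉ κ))
        (bftMesh δ (bftVert m K (bftX m δ Pre) ⌈Pim / δ⌉ ι)) (bftPhi D δ (bftVert m K (bftX m δ Pre) ⌈Pim / δ⌉ ι, K + bftKoff m ι))]))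
  obtain ⟨-, -, hs0, u0, hu0, hγ0, hsp0, j0, hj0⟩ := hdata ι le_rfl (by omega)
  obtain ⟨-, -, hs1, u1, hu1, hγ1, hsp1, j1, hj1⟩ := hdata (ι + 1) (by omega) (by omega)
  obtain ⟨-, -, hs2, u2, hu2, -, hsp2, j2, hj2⟩ := hdata (ι + 2) (by omega) (by omega)
  rw [show ι + 1 + 1 = ι + 2 by ring] at hs1
  -- ordering of the window parameters
  have hst0 := bft_sposZ_step hm hδ Pre Pim ι
  have hst1 := bft_sposZ_step hm hδ Pre Pim (ι + 1)
  rw [show ι + 1 + 1 = ι + 2 by ring] at hst1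
  have htwo := bft_sposZ_two hm hδ Pre Pim ι
  have h01 : u0 ≤ u1 := (hsm.le_iff_le (hIoo _ hu0) (hIoo _ hu1)).1 (by rw [hsp0, hsp1]; linarith)
  have h12 : u1 ≤ u2 := (hsm.le_iff_le (hIoo _ hu1) (hIoo _ hu2)).1 (by rw [hsp1, hsp2]; linarith)
  have h02 : u0 < u2 := (hsm.lt_iff_lt (hIoo _ hu0) (hIoo _ hu2)).1 (by rw [hsp0, hsp2]; linarith)
  -- increments are small
  have hsmall : ∀ u u' : ℝ, u ∈ Ioo (t₀ - η) (t₀ + η) → u' ∈ Ioo (t₀ - η) (t₀ + η) → u ≤ u' →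
      |bftSpos D t₀ u' - bftSpos D t₀ u| ≤ 2 * δ → u' - u < η' := by
    intro u u' hu hu' hle hsp
    have hdist : dist (D.boundary u') (D.boundary u) < c :=
      lt_of_le_of_lt ((bft_spos_dist D hdirA hdirB (hIoo _ hu') (hIoo _ hu)).trans hsp) hδc
    obtain ⟨n, hn⟩ := htube u' u hdist
    have habs : |u' - u| ≤ 1 / 2 := by
      rw [abs_le]; constructor <;> linarith [hu.1, hu.2, hu'.1, hu'.2]
    have hn0 := bft_small_diff hη' habs hn
    subst hn0
    simp only [Int.cast_zero, sub_zero] at hn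
    exact (abs_lt.1 hn).2
  have hd01 : u1 - u0 < η' := hsmall u0 u1 hu0 hu1 h01 (by
    rw [hsp0, hsp1, abs_of_nonneg hst0.1]; exact hst0.2)
  have hd12 : u2 - u1 < η' := hsmall u1 u2 hu1 hu2 h12 (by
    rw [hsp1, hsp2, abs_of_nonneg hst1.1]; exact hst1.2)
  have hInc0 : bftInc V (bftPar D δ) (bftVert m K (bftX m δ Pre) ⌈Pim / δ⌉ ι, K + bftKoff m ι) =
      u1 - u0 :=
    bft_inc_eq V (bftPar D δ) _ hj0 (by rw [hs0]; exact hj1) h01 (by linarith)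
  have hInc1 : bftInc V (bftPar D δ) (bftVert m K (bftX m δ Pre) ⌈Pim / δ⌉ (ι + 1), K + bftKoff m (ι + 1)) =
      u2 - u1 :=
    bft_inc_eq V (bftPar D δ) _ hj1 (by rw [hs1]; exact hj2) h12 (by linarith)
  refine ⟨by rw [hInc0]; exact hd01, ?_, fun h0 => ?_⟩
  · -- (L2)
    intro d'' hd'' hdt'' j h1 h2
    rw [hInc0, hj0] at h2
    rw [hj0] at h1
    rw [hs0, hs1]
    obtain ⟨v'', k''⟩ := d''
    simp only at hd''
    have hvcl'' : bftMesh δ v'' ∈ closure D.carrier := (hV _).1 hd''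
    have hdtk'' : v'' + dir k'' ∉ V := hdt''
    have htcl'' : bftMesh δ (dartTip (v'', k'')) ∉ closure D.carrier := fun h => hdt'' ((hV _).2 h)
    have hfr'' := bft_phi_frontier D hδ.le (v'', k'') hvcl'' htcl''
    obtain ⟨-, hγpar⟩ := bft_par_spec D (v'', k'') hfr''
    -- the window parameter of the foot of `d''`
    set u := bftPar D δ (v'', k'') + j - j0 with hu
    have hu0u : u0 < u := by rw [hu]; linarith
    have huu1 : u ≤ u1 := by rw [hu]; linarith
    have huwin : u ∈ Icc (t₀ - η) (t₀ + η) := ⟨by linarith [hu0.1], by linarith [hu1.2]⟩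
    have hγu : D.boundary u = bftPhi D δ (v'', k'') := by
      rw [← hγpar, hu, show bftPar D δ (v'', k'') + (j : ℝ) - j0 =
        bftPar D δ (v'', k'') + ((j - j0 : ℤ) : ℝ) by push_cast; ring]
      exact bft_boundary_add_int D _ (j - j0)
    have hsu1 : bftSpos D t₀ u0 < bftSpos D t₀ u := (hsm.lt_iff_lt (hIoo _ hu0) huwin).2 hu0u
    have hsu2 : bftSpos D t₀ u ≤ bftSpos D t₀ u1 := (hsm.le_iff_le huwin (hIoo _ hu1)).2 huu1
    -- the foot of `d''` is within `2 δ` of the foot of `d`, so `d''` is a chain dart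
    have hnear'' : dist (bftPhi D δ (v'', k'')) (bftPhi D δ (bftVert m K (bftX m δ Pre) ⌈Pim / δ⌉ ι,
        K + bftKoff m ι)) ≤ 2 * δ := by
      rw [← hγu, ← hγ0]
      refine (bft_spos_dist D hdirA hdirB huwin (hIoo _ hu0)).trans ?_
      rw [abs_of_pos (by linarith), hsp0]
      rw [hsp1] at hsu2
      linarith [hst0.2]
    have hdζ'' : dist (bftPhi D δ (v'', k'')) (bftMesh δ v'') ≤ δ :=
      (bft_dist_phi_mesh D hδ.le (v'', k'') hvcl'').2
    have hv''near : dist (bftMesh δ v'') (bftPhi D δ (bftVert m K (bftX m δ Pre) ⌈Pim / δ⌉ ι,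
        K + bftKoff m ι)) ≤ 13 * δ := by
      rw [dist_comm] at hdζ''
      linarith [dist_triangle (bftMesh δ v'') (bftPhi D δ (v'', k''))
        (bftPhi D δ (bftVert m K (bftX m δ Pre) ⌈Pim / δ⌉ ι, K + bftKoff m ι))]
    have hch'' := bft_frame_chart D hδ hV K hm hclos v'' (hB v'' hv''near)
    rw [← hPre, ← hPim] at hch''
    obtain ⟨hdv'', hdk''⟩ := bft_enum V hm K (bftX m δ Pre) ⌈Pim / δ⌉ v'' k'' hch'' hd'' hdtk''
    generalize bftIdx m K (bftX m δ Pre) ⌈Pim / δ⌉ v'' k'' = κ at hdv'' hdk''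
    subst hdv'' hdk''
    obtain ⟨-, -, -, u', hu', hγu', hsu', -⟩ :=
      bft_chain_data D hδ hV K hη hm hdirA hrA hdirB hrB hclos hPre hPim κ (hB _ hv''near)
    have huu' : u' = u := bft_window_inj D hη4 (hIoo _ hu') huwin (by rw [hγu', hγu])
    rw [huu'] at hsu'
    rw [hsu', hsp0] at hsu1
    rw [hsu', hsp1] at hsu2
    have hκ1 : ι + 1 ≤ κ := by
      by_contra hc
      have := (bft_sposZ_mono hm hδ Pre Pim (show κ ≤ ι by omega)).1
      linarith
    have hκ2 : κ ≤ ι + 2 := by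
      by_contra hc
      have := (bft_sposZ_mono hm hδ Pre Pim (show ι + 1 ≤ κ by omega)).2 (by omega)
      linarith
    rcases (show κ = ι + 1 ∨ κ = ι + 2 by omega) with rfl | rfl
    · exact Or.inl rfl
    · exact Or.inr rfl
  · -- (L3)
    rw [hs0, hInc1]
    rw [hInc0] at h0
    have : u1 = u0 := by linarith
    subst this
    linarith

end Summit.CriticalPhenomena.CardyFormulaZ2.Cruxes.RectilinearCardy.ExcursionKernelCovariance

end
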